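import Summits.CriticalPhenomena.PercolationContinuityZ3.Theorems.PercNearOneGluingNoHeavyPcintMemUniformGenBounds
import Summits.CriticalPhenomena.PercolationContinuityZ3.Theorems.PercNearOneGluingNoHeavyPcintPolyCert
import HarnessLib

/-!
# CriticalPhenomena/PercolationContinuityZ3 — Theorems/PercNearOneGluingNoHeavyPcintMemUniformPolyCert.lean: the base-5 uniform certificate with POLYNOMIAL weights, checked by ONE `decide`

Lane prim-pcint, STRUCTURE rule (prim-pcint-2 GEN 18).  For a dimension-5 row list `L` (memory `τ` with states on ≤ 4 axes, e.g. the
289-row memory-8 list), row weights `W_i ∈ ℤ[X]` (the Perron vector expanded in `1/(2d)`, polynomials in `d`) and bound numerators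
`numHi, numLo ∈ ℤ[X]`, the Boolean `UPolyCert5 L W numHi numLo K c` checks, for every row `i`, that the Taylor coefficients at
`X = c` of `numHi·W_i − (2X)^K·(base_i(W) + (X−5)·fresh_i(W))`, of `(2X)^K·(…) − numLo·W_i`, and of `W_i` (strictly for the constant
one) are non-negative (…PcintPolyCert).  **`memGrowth_bounds_of_upolycert5`**: if it returns `true` then
`numLo(d)/(2d)^K ≤ μ_τ(ℤ^d) ≤ numHi(d)/(2d)^K` for EVERY `d ≥ max(5, c)` (via `memGrowth_le_of_ucertK` / `le_memGrowth_of_ucertK`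
of …PcintMemUniformGenBounds).  Consumer: …PcintMemUniformEight (memory 8, all `d ≥ 5`).

HONEST FRAMING: bookkeeping between the list checker and the real inequalities.  No `sorry`; standard axioms.  Written by prim-pcint-2
gen 18 (prover-prim-pcint-2-g18-0), 2026-08-26.
-/

noncomputable section

open Literature.Probability.Percolation Literature.Probability.LatticeModels

namespace Summit.CriticalPhenomena.PercolationContinuityZ3.Theorems.Pcint

open PolyCert

variable {d : ℕ}

/-- Row weight polynomial number `j` (default `[]`). [folklore] -/
def wPoly (W : List (List ℤ)) (j : ℕ) : List ℤ := W.getD j []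

/-- The row polynomial `base_i(W) + (X − 5)·fresh_i(W)` of a dimension-5 list. [folklore] -/
def rowPoly5 (L : List (SCertRow 5)) (W : List (List ℤ)) (i : ℕ) : List ℤ :=
  padd (psum (((baseIdx5 L i).reduceOption).map (wPoly W)))
    (pmul [-5, 1] (psum (((freshIdx5 L i).reduceOption).map (wPoly W))))

/-- The polynomial `2X`. [folklore] -/
def twoX : List ℤ := [0, 2]

/-- Residual of the upper row inequality: `numHi·W_i − (2X)^K·row_i`. [folklore] -/
def resHi5 (L : List (SCertRow 5)) (W : List (List ℤ)) (numHi : List ℤ) (K i : ℕ) : List ℤ :=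
  padd (pmul numHi (wPoly W i)) (psmul (-1) (pmul (ppow twoX K) (rowPoly5 L W i)))

/-- Residual of the lower row inequality: `(2X)^K·row_i − numLo·W_i`. [folklore] -/
def resLo5 (L : List (SCertRow 5)) (W : List (List ℤ)) (numLo : List ℤ) (K i : ℕ) : List ℤ :=
  padd (pmul (ppow twoX K) (rowPoly5 L W i)) (psmul (-1) (pmul numLo (wPoly W i)))

/-- **The polynomial certificate** (decidable): every row's two residuals have non-negative Taylor coefficients at `c` and every
weight is positive from `c` on. [folklore] -/
def UPolyCert5 (L : List (SCertRow 5)) (W : List (List ℤ)) (numHi numLo : List ℤ) (K : ℕ) (c : ℤ) : Bool :=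
  (List.range L.length).all fun i =>
    allNonneg (pshift (resHi5 L W numHi K i) c) && allNonneg (pshift (resLo5 L W numLo K i) c) &&
      posHead (pshift (wPoly W i) c)

/-- A list sum of `optValR` equals the sum over the present indices. [folklore] -/
theorem sum_map_optValR_eq (w : ℕ → ℝ) : ∀ l : List (Option ℕ), (l.map (optValR w)).sum = ((l.reduceOption).map w).sum
  | [] => by simp [List.reduceOption]
  | none :: l => by simp [List.reduceOption, sum_map_optValR_eq w l]
  | some j :: l => by simp [List.reduceOption, sum_map_optValR_eq w l]

/-- The row polynomial evaluates to the row sum of …PcintMemUniformGenBounds (`k = 4`). [folklore] -/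
theorem peval_rowPoly5 (L : List (SCertRow 5)) (W : List (List ℤ)) (i : ℕ) (x : ℝ) :
    peval (rowPoly5 L W i) x =
      baseSumK (k := 4) L (fun j => peval (wPoly W j) x) i + (x - 5) * freshSumK (k := 4) L (fun j => peval (wPoly W j) x) i := by
  rw [rowPoly5, peval_padd, peval_pmul, peval_psum, peval_psum, baseSum5_eq, freshSum5_eq, sum_map_optValR_eq,
    sum_map_optValR_eq, List.map_map, List.map_map]
  have h5 : peval [-5, 1] x = x - 5 := by simp [peval]; ring
  rw [h5]
  rfl

/-- `peval twoX x = 2x`. [folklore] -/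
theorem peval_twoX (x : ℝ) : peval twoX x = 2 * x := by simp [twoX, peval]; ring

/-- **Soundness of the polynomial certificate**: `numLo(d)/(2d)^K ≤ μ_τ(ℤ^d) ≤ numHi(d)/(2d)^K` for every `d ≥ 5` with `d ≥ c`,
given a structurally valid dimension-5 list supported off axis `4` and `numLo(d) > 0`. [cite: PonitzTittmann2000, §3] -/
theorem memGrowth_bounds_of_upolycert5 [NeZero d] {τ : ℕ} {L : List (SCertRow 5)} (hτ : 2 ≤ τ) (hd : 5 ≤ d)
    (hU : UStructK (k := 4) τ L) (hS : USuppK (k := 4) L) {W : List (List ℤ)} {numHi numLo : List ℤ} {K : ℕ} {c : ℤ}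
    (hc : (c : ℝ) ≤ d) (hcert : UPolyCert5 L W numHi numLo K c = true) (hlo : 0 < peval numLo d) :
    peval numLo d / (2 * (d : ℝ)) ^ K ≤ MemoryTail.memGrowth d τ ∧
      MemoryTail.memGrowth d τ ≤ peval numHi d / (2 * (d : ℝ)) ^ K := by
  set w : ℕ → ℝ := fun j => peval (wPoly W j) d with hw
  have h0 : 0 < L.length := hU.1
  have hd' : (5 : ℝ) ≤ d := by exact_mod_cast hd
  have hdpos : (0 : ℝ) < d := by linarith
  have hpowpos : (0 : ℝ) < (2 * (d : ℝ)) ^ K := by positivity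
  -- unpack the certificate row by row
  have hrow : ∀ i < L.length,
      0 ≤ peval (resHi5 L W numHi K i) d ∧ 0 ≤ peval (resLo5 L W numLo K i) d ∧ 0 < w i := by
    intro i hi
    have h := List.all_eq_true.1 hcert i (List.mem_range.2 hi)
    simp only [Bool.and_eq_true] at h
    exact ⟨peval_nonneg_of_shift h.1.1 hc, peval_nonneg_of_shift h.1.2 hc, peval_pos_of_shift h.2 hc⟩
  have hrowval : ∀ i, peval (rowPoly5 L W i) d =
      baseSumK (k := 4) L w i + ((d : ℝ) - (4 + 1)) * freshSumK (k := 4) L w i := by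
    intro i; rw [peval_rowPoly5, hw]; norm_num
  have hhi' : ∀ i < L.length,
      baseSumK (k := 4) L w i + ((d : ℝ) - (4 + 1)) * freshSumK (k := 4) L w i ≤ peval numHi d / (2 * (d : ℝ)) ^ K * w i := by
    intro i hi
    have h := (hrow i hi).1
    rw [resHi5, peval_padd, peval_pmul, peval_psmul, peval_pmul, peval_ppow, peval_twoX, hrowval] at h
    push_cast at h
    rw [div_mul_eq_mul_div, le_div_iff₀ hpowpos]
    show _ * _ ≤ peval numHi ↑d * w i
    nlinarith
  have hlo' : ∀ i < L.length,
      peval numLo d / (2 * (d : ℝ)) ^ K * w i ≤ baseSumK (k := 4) L w i + ((d : ℝ) - (4 + 1)) * freshSumK (k := 4) L w i := by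
    intro i hi
    have h := (hrow i hi).2.1
    rw [resLo5, peval_padd, peval_pmul, peval_psmul, peval_pmul, peval_ppow, peval_twoX, hrowval] at h
    push_cast at h
    rw [div_mul_eq_mul_div, div_le_iff₀ hpowpos]
    show peval numLo ↑d * w i ≤ _ * _
    nlinarith
  have hwpos : ∀ i < L.length, 0 < w i := fun i hi => (hrow i hi).2.2
  have hhiPos : 0 < peval numHi d := by
    have h1 := hhi' 0 h0
    have h2 := hlo' 0 h0
    have hw0 := hwpos 0 h0
    have : 0 < peval numLo d / (2 * (d : ℝ)) ^ K * w 0 := mul_pos (div_pos hlo hpowpos) hw0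
    have h3 : 0 < peval numHi d / (2 * (d : ℝ)) ^ K * w 0 := by linarith
    have h4 : 0 < peval numHi d / (2 * (d : ℝ)) ^ K := pos_of_mul_pos_left h3 hw0.le
    exact (div_pos_iff_of_pos_right hpowpos).1 h4
  exact ⟨le_memGrowth_of_ucertK hτ hd hU hS w _ (div_pos hlo hpowpos) hwpos hlo',
    memGrowth_le_of_ucertK hτ hd hU hS w _ (div_pos hhiPos hpowpos) hwpos hhi'⟩

end Summit.CriticalPhenomena.PercolationContinuityZ3.Theorems.Pcint
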